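import Mathlib.Analysis.Calculus.FDeriv.Symmetric
import Mathlib.Analysis.Calculus.Deriv.Mul
import Literature.NumberTheory.Automorphic.ArchimedeanLieDerivSmooth
import HarnessLib

/-!
# The Lie derivative is a Lie algebra action: `[X, Y] φ = X (Y φ) - Y (X φ)`

Topic `NumberTheory/Automorphic`. Let `H : RealMatrixGroup A N` be the *full* linear group
(`H.lie = ⊤` and `H.carrier = ⊤`, e.g. `RealMatrixGroup.gl` and the archimedean group
`archGroupGL n K = GL_n(K_∞)` of the `GL_n` automorphy datum) over a finite-dimensional coefficient
algebra `A`, `ι : H → G` a homomorphism into a group, and `φ : G → ℂ` smooth in the archimedean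
variable (`IsArchSmooth ι φ`). Then the Lie derivatives `X φ = d/dt φ (· ι(exp tX))|_{t=0}`
(`lieDeriv`, right-invariant differentiation) satisfy the bracket relation
`[X, Y] φ = X (Y φ) - Y (X φ)` for the commutator bracket `[X, Y] = XY - YX` on
`𝔤 = 𝔤𝔩(N, A)` (Borel–Jacquet 1979, §1.5: `𝔤`, hence `U(𝔤)`, acts on smooth functions by left-invariant
differential operators; Wallach, *Real Reductive Groups I*, §1.6; Knapp 2002, I.§10, Prop. 1.89 and
III.§1–2):

* `exists_contDiffAt_log` — a smooth local inverse `log` of the matrix exponential at `1`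
  (inverse function theorem);
* `lieDeriv_bracket_of_top` — the bracket relation for `H.lie = ⊤ = H.carrier`;
* `lieDeriv_bracket_gl` — in particular on `GL_n(𝔸_K)` for the `GL_n` datum.

Proof (left-invariant vector fields on the open set `GL(N, A) ⊂ 𝔤𝔩(N, A)`): for fixed `g` put
`F(M) = φ (g ι(M))` for invertible `M` (junk elsewhere). Near an invertible `M₀` one has
`F(M) = Φ_{g ι(M₀)} (log (M₀⁻¹ M))` with `Φ_{g'} = (Z ↦ φ (g' ι(exp Z)))` smooth, so `F` is `C^∞` on
`GL(N, A)` (`exists_contDiffAt_log`). By the chain rule `(Y φ)(g ι(u)) = DF(u)(u Y)` (the curve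
`t ↦ u exp(tY)` has velocity `u Y`), hence, differentiating once more along `s ↦ exp(sX)`,
`(X (Y φ))(g) = D²F(1)(X, Y) + DF(1)(X Y)`; antisymmetrising, the symmetric second derivative
(`ContDiffAt.isSymmSndFDerivAt`) cancels and `DF(1)(XY - YX) = ([X, Y] φ)(g)` remains. No
Baker–Campbell–Hausdorff theory is used. Everything here is proved.

## References

* A. Borel, H. Jacquet, *Automorphic forms and automorphic representations*, Proc. Sympos. Pure
  Math. 33 (1979), part 1, §1.5 [BorelJacquet1979].
* N. R. Wallach, *Real Reductive Groups I* (1988), §1.6 [WallachRRG1].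
* A. W. Knapp, *Lie Groups Beyond an Introduction* (2002), I.§10, Prop. 1.89 [Knapp2002].
-/

noncomputable section

open scoped MatrixGroups Matrix ContDiff Topology
open Filter

namespace Literature.NumberTheory.Automorphic

/-! ### A smooth local logarithm -/

section Log

variable {A : Type*} [NormedCommRing A] [NormedAlgebra ℝ A] [NormedAlgebra ℚ A] [CompleteSpace A]
  {N : Type*} [Fintype N] [DecidableEq N]

-- As in `Mathlib/Analysis/Normed/Algebra/MatrixExponential.lean` and `ArchimedeanLieDerivSmooth`: the
-- scoped `L∞`-operator normed ring structure on matrices is only reducibly-defeq to the Pi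
-- uniformity, so `CompleteSpace (Matrix N N A)` and the analytic facts about `exp` need this setting.
omit [NormedAlgebra ℚ A] in
set_option backward.isDefEq.respectTransparency false in
open scoped Matrix.Norms.Operator in
/-- **A smooth local logarithm.** There is a function `log : 𝔤𝔩(N, A) → 𝔤𝔩(N, A)` which is `C^∞`
at `1` and inverts the matrix exponential near `1`: `exp (log y) = y` for `y` near `1` (inverse
function theorem at `0`, where `exp` has derivative `1`; `exp` is analytic).
Knapp 2002, 0.§2–§3 and I.§10. [folklore] -/
theorem exists_contDiffAt_log :
    ∃ log : Matrix N N A → Matrix N N A, ContDiffAt ℝ ∞ log 1 ∧ log 1 = 0 ∧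
      ∀ᶠ y in 𝓝 (1 : Matrix N N A), NormedSpace.exp (log y) = y := by
  have hexp : ContDiff ℝ ∞ (NormedSpace.exp : Matrix N N A → Matrix N N A) :=
    contDiff_iff_contDiffAt.2 fun M => (NormedSpace.exp_analytic (𝕂 := ℝ) M).contDiffAt
  have hexp0 : HasFDerivAt (NormedSpace.exp : Matrix N N A → Matrix N N A)
      ((ContinuousLinearEquiv.refl ℝ (Matrix N N A) : Matrix N N A ≃L[ℝ] Matrix N N A) :
        Matrix N N A →L[ℝ] Matrix N N A) 0 :=
    (hasFDerivAt_exp_zero (𝕂 := ℝ) (𝔸 := Matrix N N A)).congr_fderiv (by ext M; simp)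
  have hn : (∞ : WithTop ℕ∞) ≠ 0 := by simp
  refine ⟨hexp.contDiffAt.localInverse hexp0 hn, ?_, ?_, ?_⟩
  · have := hexp.contDiffAt.to_localInverse hexp0 hn
    rwa [NormedSpace.exp_zero] at this
  · have := hexp.contDiffAt.localInverse_apply_image hexp0 hn
    rwa [NormedSpace.exp_zero] at this
  · have := (hexp.contDiffAt.hasStrictFDerivAt' hexp0 hn).eventually_right_inverse
    rwa [NormedSpace.exp_zero] at this

end Log

/-! ### The bracket relation -/

section General

variable {A : Type*} [NormedCommRing A] [NormedAlgebra ℝ A] [NormedAlgebra ℚ A] [CompleteSpace A]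
  [StarRing A] {N : Type*} [Fintype N] [DecidableEq N] {H : RealMatrixGroup A N}
  {G : Type*} [Group G] (ι : H.carrier →* G)

set_option backward.isDefEq.respectTransparency false in
open scoped Matrix.Norms.Operator in
/-- **The Lie derivative is a Lie algebra action on smooth functions** (`𝔤 = 𝔤𝔩(N, A)`): if
`H.lie = ⊤`, `H.carrier = ⊤`, `A` is finite-dimensional and `φ` is smooth in the archimedean
variable, then `[X, Y] φ = X (Y φ) - Y (X φ)` for all `X, Y ∈ 𝔤`. With `F(M) = φ (g ι(M))` on the
open set of invertible matrices, `(Y φ)(g ι(u)) = DF(u)(u Y)` and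
`(X (Y φ))(g) = D²F(1)(X, Y) + DF(1)(XY)`; the symmetric second derivative cancels in the
antisymmetrisation. Borel–Jacquet 1979, §1.5; Knapp 2002, I.§10, Prop. 1.89.
[cite: BorelJacquet1979, §1.5] -/
theorem lieDeriv_bracket_of_top [FiniteDimensional ℝ A] (hH : H.lie = ⊤) (hc : H.carrier = ⊤)
    (X Y : H.lie) {φ : G → ℂ} (hφ : IsArchSmooth ι φ) :
    lieDeriv ι ⁅X, Y⁆ φ = lieDeriv ι X (lieDeriv ι Y φ) - lieDeriv ι Y (lieDeriv ι X φ) := by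
  classical
  -- Mathlib idiom (Mathlib/Algebra/Lie/OfAssociative.lean): the commutator Lie ring on matrices
  letI : LieRing (Matrix N N A) := LieRing.ofAssociativeRing
  have hmem : ∀ M : Matrix N N A, M ∈ H.lie := fun M => by rw [hH]; exact LieSubalgebra.mem_top M
  have hcar : ∀ u : GL N A, u ∈ H.carrier := fun u => by rw [hc]; exact Subgroup.mem_top u
  -- exponential and inclusion of units into `H`
  let E : Matrix N N A → H.carrier := fun M => H.expMem ⟨M, hmem M⟩
  let U : GL N A → H.carrier := fun u => ⟨u, hcar u⟩
  have hU_mul : ∀ u v : GL N A, U (u * v) = U u * U v := fun u v => rfl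
  have hU_one : U 1 = 1 := rfl
  have hU_exp : ∀ M : Matrix N N A, U (expGL M) = E M := fun M => rfl
  -- the slices of `φ` as functions on all of `𝔤𝔩(N, A)` are smooth
  let incl : Matrix N N A →ₗ[ℝ] H.lie.toSubmodule :=
    LinearMap.codRestrict H.lie.toSubmodule LinearMap.id fun M => hmem M
  have hincl : ContDiff ℝ ∞ (incl : Matrix N N A → H.lie.toSubmodule) :=
    (⟨incl, incl.continuous_of_finiteDimensional⟩ : Matrix N N A →L[ℝ] H.lie.toSubmodule).contDiff
  have hΦ : ∀ g' : G, ContDiff ℝ ∞ fun M : Matrix N N A => φ (g' * ι (E M)) := fun g' =>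
    (hφ g').comp hincl
  -- the smooth local logarithm
  obtain ⟨log, hlog, -, hright⟩ := exists_contDiffAt_log (A := A) (N := N)
  funext g
  -- `F(M) = φ (g ι(M))` for invertible `M`, junk elsewhere
  let unitOf : Matrix N N A → GL N A := fun M => if h : IsUnit M then h.unit else 1
  have hunitOf : ∀ u : GL N A, unitOf (u : Matrix N N A) = u := fun u => by
    simp only [unitOf, dif_pos (Units.isUnit u), IsUnit.unit_of_val_units]
  let F : Matrix N N A → ℂ := fun M => φ (g * ι (U (unitOf M)))
  have hFU : ∀ u : GL N A, F (u : Matrix N N A) = φ (g * ι (U u)) := fun u => by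
    simp only [F, hunitOf]
  -- `F` is smooth at every invertible matrix (exponential chart at `u₀`)
  have hFsmooth : ∀ u₀ : GL N A, ContDiffAt ℝ ∞ F (u₀ : Matrix N N A) := by
    intro u₀
    have hP : ContDiff ℝ ∞ fun M : Matrix N N A => ((u₀⁻¹ : GL N A) : Matrix N N A) * M :=
      contDiff_const.mul contDiff_id
    have hP0 : ((u₀⁻¹ : GL N A) : Matrix N N A) * (u₀ : Matrix N N A) = 1 := Units.inv_mul u₀
    have hG : ContDiffAt ℝ ∞
        (fun M : Matrix N N A => φ (g * ι (U u₀) * ι (E (log (((u₀⁻¹ : GL N A) : Matrix N N A) * M)))))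
        (u₀ : Matrix N N A) := by
      have h1 : ContDiffAt ℝ ∞ (fun M : Matrix N N A => log (((u₀⁻¹ : GL N A) : Matrix N N A) * M))
          (u₀ : Matrix N N A) := by
        refine ContDiffAt.comp (u₀ : Matrix N N A) ?_ hP.contDiffAt
        rwa [hP0]
      exact ((hΦ (g * ι (U u₀))).contDiffAt).comp (u₀ : Matrix N N A) h1
    have hPcont : Tendsto (fun M : Matrix N N A => ((u₀⁻¹ : GL N A) : Matrix N N A) * M)
        (𝓝 (u₀ : Matrix N N A)) (𝓝 1) := by
      have := hP.continuous.continuousAt (x := (u₀ : Matrix N N A))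
      rwa [ContinuousAt, hP0] at this
    refine hG.congr_of_eventuallyEq ?_
    filter_upwards [hPcont.eventually hright] with M hM
    -- `M = u₀ exp (log (u₀⁻¹ M))` is invertible
    have hMeq : M = ((u₀ * expGL (log (((u₀⁻¹ : GL N A) : Matrix N N A) * M)) : GL N A) :
        Matrix N N A) := by
      rw [Units.val_mul, coe_expGL, hM, Units.mul_inv_cancel_left]
    calc F M = F ((u₀ * expGL (log (((u₀⁻¹ : GL N A) : Matrix N N A) * M)) : GL N A) :
          Matrix N N A) := by rw [← hMeq]
      _ = φ (g * ι (U u₀) * ι (E (log (((u₀⁻¹ : GL N A) : Matrix N N A) * M)))) := by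
          rw [hFU, hU_mul, hU_exp, map_mul, mul_assoc]
  -- first derivatives: `(Z φ)(g ι(u)) = DF(u)(u Z)`
  have hD1 : ∀ (u : GL N A) (Z : H.lie),
      lieDeriv ι Z φ (g * ι (U u)) = fderiv ℝ F (u : Matrix N N A) ((u : Matrix N N A) * (Z : Matrix N N A)) := by
    intro u Z
    have hγ : HasDerivAt (fun t : ℝ => (u : Matrix N N A) * NormedSpace.exp (t • (Z : Matrix N N A)))
        ((u : Matrix N N A) * (Z : Matrix N N A)) 0 := by
      have := (hasDerivAt_exp_smul_const' (𝕂 := ℝ) (Z : Matrix N N A) (0 : ℝ)).const_mul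
        (u : Matrix N N A)
      simpa using this
    have hcomp : HasDerivAt
        (fun t : ℝ => F ((u : Matrix N N A) * NormedSpace.exp (t • (Z : Matrix N N A))))
        (fderiv ℝ F (u : Matrix N N A) ((u : Matrix N N A) * (Z : Matrix N N A))) 0 := by
      have hFd : DifferentiableAt ℝ F ((u : Matrix N N A) * NormedSpace.exp ((0 : ℝ) • (Z : Matrix N N A))) := by
        rw [zero_smul, NormedSpace.exp_zero, mul_one]
        exact (hFsmooth u).differentiableAt (by simp)
      have := hFd.hasFDerivAt.comp_hasDerivAt (0 : ℝ) hγ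
      rwa [zero_smul, NormedSpace.exp_zero, mul_one] at this
    have hfun : (fun t : ℝ => φ (g * ι (U u) * ι (H.expMem (t • Z)))) =
        fun t : ℝ => F ((u : Matrix N N A) * NormedSpace.exp (t • (Z : Matrix N N A))) := by
      funext t
      have : (u : Matrix N N A) * NormedSpace.exp (t • (Z : Matrix N N A)) =
          ((u * expGL (t • (Z : Matrix N N A)) : GL N A) : Matrix N N A) := by
        rw [Units.val_mul, coe_expGL]
      rw [this, hFU, hU_mul, map_mul, mul_assoc]
      rfl
    change deriv (fun t : ℝ => φ (g * ι (U u) * ι (H.expMem (t • Z)))) 0 = _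
    rw [hfun, hcomp.deriv]
  -- second derivatives: `(X (Y φ))(g) = D²F(1)(X, Y) + DF(1)(X Y)`
  have hD2 : ∀ X Y : H.lie, lieDeriv ι X (lieDeriv ι Y φ) g =
      fderiv ℝ (fderiv ℝ F) 1 (X : Matrix N N A) (Y : Matrix N N A) +
        fderiv ℝ F 1 ((X : Matrix N N A) * (Y : Matrix N N A)) := by
    intro X Y
    -- the curve `γ(s) = exp(sX)` and the values of `Y φ` along it
    have hγ : HasDerivAt (fun s : ℝ => NormedSpace.exp (s • (X : Matrix N N A))) (X : Matrix N N A) 0 := by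
      simpa using hasDerivAt_exp_smul_const' (𝕂 := ℝ) (X : Matrix N N A) (0 : ℝ)
    have hvals : (fun s : ℝ => lieDeriv ι Y φ (g * ι (H.expMem (s • X)))) = fun s : ℝ =>
        fderiv ℝ F (NormedSpace.exp (s • (X : Matrix N N A)))
          (NormedSpace.exp (s • (X : Matrix N N A)) * (Y : Matrix N N A)) := by
      funext s
      have h1 : H.expMem (s • X) = U (expGL (s • (X : Matrix N N A))) := rfl
      rw [h1, hD1, coe_expGL]
    -- `fderiv F` is differentiable at `1`
    have hF2 : HasFDerivAt (fderiv ℝ F) (fderiv ℝ (fderiv ℝ F) 1) (1 : Matrix N N A) := by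
      have h := (hFsmooth 1).fderiv_right (m := 1) (WithTop.coe_le_coe.2 le_top)
      rw [Units.val_one] at h
      exact (h.differentiableAt (by simp)).hasFDerivAt
    have hc : HasDerivAt (fun s : ℝ => fderiv ℝ F (NormedSpace.exp (s • (X : Matrix N N A))))
        (fderiv ℝ (fderiv ℝ F) 1 (X : Matrix N N A)) 0 := by
      have hF2' : HasFDerivAt (fderiv ℝ F) (fderiv ℝ (fderiv ℝ F) 1)
          (NormedSpace.exp ((0 : ℝ) • (X : Matrix N N A))) := by
        rwa [zero_smul, NormedSpace.exp_zero]
      exact HasFDerivAt.comp_hasDerivAt (l := fderiv ℝ F)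
        (f := fun s : ℝ => NormedSpace.exp (s • (X : Matrix N N A))) (0 : ℝ) hF2' hγ
    have hu : HasDerivAt (fun s : ℝ => NormedSpace.exp (s • (X : Matrix N N A)) * (Y : Matrix N N A))
        ((X : Matrix N N A) * (Y : Matrix N N A)) 0 := hγ.mul_const _
    have hboth := hc.clm_apply hu
    simp only [zero_smul, NormedSpace.exp_zero, one_mul] at hboth
    change deriv (fun s : ℝ => lieDeriv ι Y φ (g * ι (H.expMem (s • X)))) 0 = _
    rw [hvals, hboth.deriv]
  -- the value of `[X, Y] φ` at `g`
  have hXY : lieDeriv ι ⁅X, Y⁆ φ g =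
      fderiv ℝ F 1 ((X : Matrix N N A) * (Y : Matrix N N A)) -
        fderiv ℝ F 1 ((Y : Matrix N N A) * (X : Matrix N N A)) := by
    have h := hD1 1 ⁅X, Y⁆
    rw [hU_one, map_one, mul_one, Units.val_one, one_mul, LieSubalgebra.coe_bracket,
      Ring.lie_def, map_sub] at h
    exact h
  -- symmetry of the second derivative
  have hsymm : IsSymmSndFDerivAt ℝ F (1 : Matrix N N A) := by
    have h2 : (2 : WithTop ℕ∞) ≤ ∞ := ENat.natCast_le_of_coe_top_le_withTop le_rfl 2
    have h := (hFsmooth 1).isSymmSndFDerivAt (n := ∞) (by simpa using h2)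
    rwa [Units.val_one] at h
  rw [Pi.sub_apply, hD2 X Y, hD2 Y X, hXY, hsymm (X : Matrix N N A) (Y : Matrix N N A)]
  abel

end General

/-! ### The `GL_n` datum -/

section GLn

open scoped Classical
open NumberField NumberField.mixedEmbedding IsDedekindDomain

variable {n : ℕ} {K : Type} [Field K] [NumberField K] {hcpt : isCompact_glFiniteIntegralLevel n K}

/-- **The bracket relation on `GL_n(𝔸_K)`**: for `φ : GL_n(𝔸_K) → ℂ` smooth in the archimedean
variable and `X, Y ∈ 𝔤𝔩_n(K_∞)`, `[X, Y] φ = X (Y φ) - Y (X φ)` (`lieDeriv_bracket_of_top` for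
`archGroupGL n K = GL_n(K_∞)`, whose Lie algebra and carrier are everything).
Borel–Jacquet 1979, §1.5 and §4.1. [cite: BorelJacquet1979, §1.5] -/
theorem lieDeriv_bracket_gl {φ : (AdelicGroupData.gl n K).Adelic → ℂ}
    (hφ : IsArchSmooth (AutomorphyDatum.gl n K hcpt).ofArch φ)
    (X Y : (AutomorphyDatum.gl n K hcpt).arch.lie) :
    lieDeriv (AutomorphyDatum.gl n K hcpt).ofArch ⁅X, Y⁆ φ =
      lieDeriv (AutomorphyDatum.gl n K hcpt).ofArch X
          (lieDeriv (AutomorphyDatum.gl n K hcpt).ofArch Y φ) -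
        lieDeriv (AutomorphyDatum.gl n K hcpt).ofArch Y
          (lieDeriv (AutomorphyDatum.gl n K hcpt).ofArch X φ) :=
  lieDeriv_bracket_of_top _ (archGroupGL_lie n K) (archGroupGL_carrier n K) X Y hφ

end GLn

end Literature.NumberTheory.Automorphic
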